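import Summits.Ventures.YMGap.RobustBall.TorusDoorVariance
import Summits.Ventures.YMGap.RobustBall.RowsSU3Certified
import HarnessLib

/-!
# Venture YMGap, track Y2 ROBUST-BALL — `SU(3)` TORUS CLUSTERING ROWS on the cell's certified pair through ds-2's
# VARIANCE-form torus door (Holley–Stroock factor, no self-Lipschitz load), every `d`; rows at `d = 4` and `d = 3`, tiers 1 and 2

HONEST FRAMING.  Venture file of the cell `pub-ymgap` (QuantumFields programme), seat engine-2 (g6).  Strong-coupling LATTICE
statements only: `SU(3)` lattice Yang–Mills on the tori `(ℤ/L)^d`, `L ≥ 3` (uniform in `L`), Wilson's action at tree coupling `β_W/3`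
('t Hooft `β_W/9`) plus a member `W` of rb-theory's tier-1 ball `ClusterDomainFR ε₀ ε₁ r` (resp. tier-2 ball `ClusterDomain κ ε₀ ε₁`);
conclusion = exponential clustering of the member's own torus Gibbs measure with explicit constant `24` and rate
(`RobustBall.TorusClusteringOnBall` / `TorusClusteringOnBallW` — the receiving currency of Y4's `YM3IR.ClusterDomainClustering` at
`d = 3`).  Nothing about `ℤ^d`/DLR (that is `RowsSU3Certified`), the continuum, weak coupling, or the Clay problem.  Kernel ARITHMETIC
over ds-2's door `torusClusteringOnBall(W)_of_poincare_of_varianceBound` (pair schemas BY NAME; row value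
`ρ_V = e^{ε₀}√(cv)(|β|/N)6(d−1) + e^{ε₀/2}√c ε₁`) fed with the cell's CERTIFIED `SU(3)` pair P11: H1 `OneLinkPoincareSUN 3 (3/5) (4/5)`
(σ2 engines A + B, two partitions; class C) restricted to radius `11/30`, and H2 `OneLinkVarianceBound 3 (11/30) (49/20)` (`pub-balaban` g17 +
`ymgap` replay; class C-iv): `√(cv) = 7/5`, `√c = √(4/5) ≤ 0.8945`, so

  `ρ_V(d, β_W, ε) = e^{2ε}·(14/15)(d−1)β_W + e^{ε}√(4/5)·ε`   (one-parameter ball `ε₀ = 2ε`, `ε₁ = ε`; radius `(d−1)β_W ≤ 33/20`).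

NOTHING is asserted about H1/H2: every row is K-conditional on them (class «K × C(H1) × C-iv(H2)»), never K.  The radius-`3/5` pair P35
(`√(cv) = √68/5`) opens this door only below `β_W = 0.31 < 5/14` and is not used.

THE ROWS (`TorusClusteringOnBall 3 d (β_W/3) (2ε) ε r 24 (−log ρ_V/(r ⊔ 1))` for EVERY range `r`; `ε` at `1/1000`, rounded down; certificates
`ρ_V ≤ T(2ε)(14/15)(d−1)β_W + T(ε)·0.8945·ε < 1`, `T(x) = 1 + x + x²/2 + x³/6 + (5/96)x⁴`):
* `d = 4` (Wilson threshold of the door `5/14`): `(β⋆_W, ε) = (1/8, .299) (1/5, .181) (1/4, .116) (3/10, .058)` — versus ds-2's `TorusRowsSU3`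
  through the U1 transfer of the black-box modulus `7/5` (`(1/8, .23) (1/5, .118) (1/4, .069)`); same numbers as the `ℤ⁴` rows of
  `RowsSU3Certified` (same row value);
* `d = 3` (threshold `15/28`): `(1/4, .230) (3/10, .181) (2/5, .096) (9/20, .058)`;
* tier 2, weight `e^{κ·diam}`, `κ = log(6/5)`: `d = 4`: `(1/8, .257) (1/5, .128)`; `d = 3`: `(1/4, .181) (1/3, .096)` (rate `log(6/5)`, constant `24`).
-/

noncomputable section

open MeasureTheory ProbabilityTheory Real
open Literature.MathematicalPhysics.QuantumFieldTheory
open Summit.QuantumFields.BalabanUV.InfraRed.StrongCouplingPoincareDoorSUN (OneLinkPoincareSUN OneLinkPoincareSUN.mono)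
open Summit.QuantumFields.BalabanUV.InfraRed.StrongCouplingVarianceDoorSUN (OneLinkVarianceBound)
open Summit.Ventures.YMGap.RobustBall (TorusClusteringOnBall TorusClusteringOnBallW
  torusClusteringOnBall_of_poincare_of_varianceBound torusClusteringOnBallW_of_poincare_of_varianceBound)

namespace Summit.Ventures.YMGap.RobustBallSU3

variable {d : ℕ}

/-! ### 1. The row value on the certified pair -/

/-- The door's row value on P11 in Wilson units: with `√(cv) = 7/5`, `|β_W/3|/3 = β_W/9` (`β_W > 0`) and `2ε/2 = ε`,
`e^{2ε}√((4/5)(49/20))(|β_W/3|/3)·6(d−1) + e^{2ε/2}√(4/5)ε = e^{2ε}(14/15)(d−1)β_W + e^{ε}√(4/5)ε`. [folklore] -/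
theorem torus_rowValue_eq {βW ε : ℝ} (hβ0 : 0 < βW) :
    exp (2 * ε) * Real.sqrt (4 / 5 * (49 / 20)) * (|βW / 3| / ((3 : ℕ) : ℝ)) * (6 * ((d : ℝ) - 1)) +
        exp (2 * ε / 2) * Real.sqrt (4 / 5) * ε =
      exp (2 * ε) * (14 / 15 * (((d : ℝ) - 1) * βW)) + exp ε * Real.sqrt (4 / 5) * ε := by
  have habs : |βW / 3| / ((3 : ℕ) : ℝ) = βW / 9 := by rw [abs_of_pos (by positivity), Nat.cast_ofNat]; ring
  have hsq : Real.sqrt (4 / 5 * (49 / 20)) = 7 / 5 := by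
    rw [show (4 / 5 * (49 / 20) : ℝ) = (7 / 5) ^ 2 by norm_num, Real.sqrt_sq (by norm_num)]
  rw [habs, hsq, show 2 * ε / 2 = ε by ring]
  ring

/-- The row value is positive for `β_W > 0`, `d ≥ 2`, `ε ≥ 0`. [folklore] -/
theorem torus_rowValue_pos (hd : 2 ≤ d) {βW ε : ℝ} (hβ0 : 0 < βW) (hε : 0 ≤ ε) :
    0 < exp (2 * ε) * (14 / 15 * (((d : ℝ) - 1) * βW)) + exp ε * Real.sqrt (4 / 5) * ε := by
  have hd1 : (0 : ℝ) < (d : ℝ) - 1 := by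
    have : (2 : ℝ) ≤ d := by exact_mod_cast hd
    linarith
  have h1 : 0 < exp (2 * ε) * (14 / 15 * (((d : ℝ) - 1) * βW)) := by positivity
  have h2 : 0 ≤ exp ε * Real.sqrt (4 / 5) * ε := by positivity
  linarith

/-- The row value under the Taylor majorant: for `0 ≤ ε ≤ 1/2`, `ρ_V ≤ T(2ε)(14/15)(d−1)β_W + T(ε)·0.8945·ε`. [folklore] -/
theorem torus_rowValue_le_taylor (hd : 2 ≤ d) {βW ε : ℝ} (hβ0 : 0 < βW) (hε0 : 0 ≤ ε) (hε1 : ε ≤ 1 / 2) :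
    exp (2 * ε) * (14 / 15 * (((d : ℝ) - 1) * βW)) + exp ε * Real.sqrt (4 / 5) * ε ≤
      (1 + 2 * ε + (2 * ε) ^ 2 / 2 + (2 * ε) ^ 3 / 6 + 5 / 96 * (2 * ε) ^ 4) * (14 / 15 * (((d : ℝ) - 1) * βW)) +
        (1 + ε + ε ^ 2 / 2 + ε ^ 3 / 6 + 5 / 96 * ε ^ 4) * 0.8945 * ε := by
  have hd1 : (0 : ℝ) ≤ (d : ℝ) - 1 := by
    have : (2 : ℝ) ≤ d := by exact_mod_cast hd
    linarith
  have h1 : exp (2 * ε) * (14 / 15 * (((d : ℝ) - 1) * βW)) ≤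
      (1 + 2 * ε + (2 * ε) ^ 2 / 2 + (2 * ε) ^ 3 / 6 + 5 / 96 * (2 * ε) ^ 4) * (14 / 15 * (((d : ℝ) - 1) * βW)) :=
    mul_le_mul_of_nonneg_right (exp_le_taylor4 (by linarith) (by linarith)) (by positivity)
  have h2 : exp ε * Real.sqrt (4 / 5) * ε ≤ (1 + ε + ε ^ 2 / 2 + ε ^ 3 / 6 + 5 / 96 * ε ^ 4) * 0.8945 * ε :=
    mul_le_mul_of_nonneg_right (mul_le_mul (exp_le_taylor4 hε0 (by linarith)) sqrt_four_fifths_le (Real.sqrt_nonneg _)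
      (by positivity)) hε0
  linarith

/-! ### 2. The conditional `SU(3)` torus currency, every `d ≥ 2`, tiers 1 and 2 -/

/-- **`SU(3)`, every `d ≥ 2`: torus clustering on the tier-1 ball through the variance door on P11** (CONDITIONAL on H1, H2).
For `0 < β_W` with `(d−1)β_W ≤ 33/20`, `0 ≤ ε` and `ρ_V = e^{2ε}(14/15)(d−1)β_W + e^{ε}√(4/5)ε < 1`: every member of
`ClusterDomainFR (2ε) ε r` clusters on every torus `(ℤ/L)^d`, `L ≥ 3`, at tree coupling `β_W/3` with constant `24` and rate
`−log ρ_V/(r ⊔ 1)`. [folklore] -/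
theorem su3_torusClusteringOnBall_variance (hd : 2 ≤ d) (hP : OneLinkPoincareSUN 3 (3 / 5) (4 / 5))
    (hV : OneLinkVarianceBound 3 (11 / 30) (49 / 20)) {βW ε : ℝ} (hβ0 : 0 < βW) (hR : ((d : ℝ) - 1) * βW ≤ 33 / 20)
    (hε : 0 ≤ ε) (r : ℕ) (hρ1 : exp (2 * ε) * (14 / 15 * (((d : ℝ) - 1) * βW)) + exp ε * Real.sqrt (4 / 5) * ε < 1) :
    TorusClusteringOnBall 3 d (βW / 3) (2 * ε) ε r 24
      (-Real.log (exp (2 * ε) * (14 / 15 * (((d : ℝ) - 1) * βW)) + exp ε * Real.sqrt (4 / 5) * ε) / max r 1) := by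
  have hb : |βW / 3| / ((3 : ℕ) : ℝ) * (2 * ((d : ℝ) - 1)) ≤ 11 / 30 := by
    rw [abs_of_pos (by positivity), Nat.cast_ofNat]; nlinarith
  have hform := torus_rowValue_eq (d := d) (ε := ε) hβ0
  have h := torusClusteringOnBall_of_poincare_of_varianceBound (d := d) (N := 3) (by omega) (by norm_num)
    (β := βW / 3) (ε₀ := 2 * ε) (ε₁ := ε) (by norm_num) (by norm_num) hb (hP.mono (by norm_num) le_rfl) hV r
    (by rw [hform]; exact torus_rowValue_pos hd hβ0 hε) (by rw [hform]; exact hρ1)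
  have h24 : (8 : ℝ) * ((3 : ℕ) : ℝ) = 24 := by norm_num
  rw [hform, h24] at h
  exact h

/-- **`SU(3)`, every `d ≥ 2`: torus clustering on the TIER-2 ball `ClusterDomain κ (2ε) ε` through the variance door on P11**
(CONDITIONAL on H1, H2): for `κ ≥ 0`, `0 < β_W`, `(d−1)β_W ≤ 33/20`, `0 ≤ ε` and `e^{κ}e^{2ε}(14/15)(d−1)β_W + e^{ε}√(4/5)ε < 1`:
clustering with constant `24` and rate `κ` on every torus `L ≥ 3`. [folklore] -/
theorem su3_torusClusteringOnBallW_variance (hd : 2 ≤ d) (hP : OneLinkPoincareSUN 3 (3 / 5) (4 / 5))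
    (hV : OneLinkVarianceBound 3 (11 / 30) (49 / 20)) {κ βW ε : ℝ} (hκ : 0 ≤ κ) (hβ0 : 0 < βW)
    (hR : ((d : ℝ) - 1) * βW ≤ 33 / 20) (hε : 0 ≤ ε)
    (hρ1 : exp κ * (exp (2 * ε) * (14 / 15 * (((d : ℝ) - 1) * βW))) + exp ε * Real.sqrt (4 / 5) * ε < 1) :
    TorusClusteringOnBallW 3 d (βW / 3) κ (2 * ε) ε 24 κ := by
  have hb : |βW / 3| / ((3 : ℕ) : ℝ) * (2 * ((d : ℝ) - 1)) ≤ 11 / 30 := by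
    rw [abs_of_pos (by positivity), Nat.cast_ofNat]; nlinarith
  have hform : exp κ * exp (2 * ε) * Real.sqrt (4 / 5 * (49 / 20)) * (|βW / 3| / ((3 : ℕ) : ℝ)) * (6 * ((d : ℝ) - 1)) +
        exp (2 * ε / 2) * Real.sqrt (4 / 5) * ε =
      exp κ * (exp (2 * ε) * (14 / 15 * (((d : ℝ) - 1) * βW))) + exp ε * Real.sqrt (4 / 5) * ε := by
    have habs : |βW / 3| / ((3 : ℕ) : ℝ) = βW / 9 := by rw [abs_of_pos (by positivity), Nat.cast_ofNat]; ring
    have hsq : Real.sqrt (4 / 5 * (49 / 20)) = 7 / 5 := by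
      rw [show (4 / 5 * (49 / 20) : ℝ) = (7 / 5) ^ 2 by norm_num, Real.sqrt_sq (by norm_num)]
    rw [habs, hsq, show 2 * ε / 2 = ε by ring]
    ring
  have h := torusClusteringOnBallW_of_poincare_of_varianceBound (d := d) (N := 3) (by omega) (by norm_num)
    (β := βW / 3) (κ := κ) (ε₀ := 2 * ε) (ε₁ := ε) hκ (by norm_num) (by norm_num) hb (hP.mono (by norm_num) le_rfl) hV hε
    (by rw [hform]; exact hρ1)
  have h24 : (8 : ℝ) * ((3 : ℕ) : ℝ) = 24 := by norm_num
  rw [h24] at h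
  exact h

/-! ### 3. Row schemas with rational certificates -/

/-- **Tier-1 row schema, every `d ≥ 2`**: `0 < β_W`, `(d−1)β_W ≤ 33/20`, `0 ≤ ε ≤ 1/2` and the RATIONAL certificate
`T(2ε)(14/15)(d−1)β_W + T(ε)·0.8945·ε < 1` give the tier-1 torus row at `(β_W, ε)` with the exact rate `−log ρ_V/(r ⊔ 1) > 0`. [folklore] -/
theorem su3_torusRow (hd : 2 ≤ d) (hP : OneLinkPoincareSUN 3 (3 / 5) (4 / 5)) (hV : OneLinkVarianceBound 3 (11 / 30) (49 / 20))
    {βW ε : ℝ} (hβ0 : 0 < βW) (hR : ((d : ℝ) - 1) * βW ≤ 33 / 20) (hε0 : 0 ≤ ε) (hε1 : ε ≤ 1 / 2) (r : ℕ)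
    (hcert : (1 + 2 * ε + (2 * ε) ^ 2 / 2 + (2 * ε) ^ 3 / 6 + 5 / 96 * (2 * ε) ^ 4) * (14 / 15 * (((d : ℝ) - 1) * βW)) +
        (1 + ε + ε ^ 2 / 2 + ε ^ 3 / 6 + 5 / 96 * ε ^ 4) * 0.8945 * ε < 1) :
    TorusClusteringOnBall 3 d (βW / 3) (2 * ε) ε r 24
      (-Real.log (exp (2 * ε) * (14 / 15 * (((d : ℝ) - 1) * βW)) + exp ε * Real.sqrt (4 / 5) * ε) / max r 1) :=
  su3_torusClusteringOnBall_variance hd hP hV hβ0 hR hε0 r (lt_of_le_of_lt (torus_rowValue_le_taylor hd hβ0 hε0 hε1) hcert)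

/-- The tier-1 rate of a certified row is positive. [folklore] -/
theorem su3_torusRow_rate_pos (hd : 2 ≤ d) {βW ε : ℝ} (hβ0 : 0 < βW) (hε0 : 0 ≤ ε) (hε1 : ε ≤ 1 / 2) (r : ℕ)
    (hcert : (1 + 2 * ε + (2 * ε) ^ 2 / 2 + (2 * ε) ^ 3 / 6 + 5 / 96 * (2 * ε) ^ 4) * (14 / 15 * (((d : ℝ) - 1) * βW)) +
        (1 + ε + ε ^ 2 / 2 + ε ^ 3 / 6 + 5 / 96 * ε ^ 4) * 0.8945 * ε < 1) :
    0 < -Real.log (exp (2 * ε) * (14 / 15 * (((d : ℝ) - 1) * βW)) + exp ε * Real.sqrt (4 / 5) * ε) / max r 1 :=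
  div_pos (neg_pos.2 (Real.log_neg (torus_rowValue_pos hd hβ0 hε0)
    (lt_of_le_of_lt (torus_rowValue_le_taylor hd hβ0 hε0 hε1) hcert))) (by positivity)

/-- **Tier-2 row schema, every `d ≥ 2`, weight `e^{κ·diam}` with `e^κ ≤ k`** (`κ ≥ 0`): the RATIONAL certificate
`k·T(2ε)(14/15)(d−1)β_W + T(ε)·0.8945·ε < 1` gives `TorusClusteringOnBallW 3 d (β_W/3) κ (2ε) ε 24 κ`. [folklore] -/
theorem su3_torusRowW (hd : 2 ≤ d) (hP : OneLinkPoincareSUN 3 (3 / 5) (4 / 5)) (hV : OneLinkVarianceBound 3 (11 / 30) (49 / 20))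
    {κ k βW ε : ℝ} (hκ : 0 ≤ κ) (hk : exp κ ≤ k) (hβ0 : 0 < βW) (hR : ((d : ℝ) - 1) * βW ≤ 33 / 20) (hε0 : 0 ≤ ε)
    (hε1 : ε ≤ 1 / 2)
    (hcert : k * ((1 + 2 * ε + (2 * ε) ^ 2 / 2 + (2 * ε) ^ 3 / 6 + 5 / 96 * (2 * ε) ^ 4) * (14 / 15 * (((d : ℝ) - 1) * βW))) +
        (1 + ε + ε ^ 2 / 2 + ε ^ 3 / 6 + 5 / 96 * ε ^ 4) * 0.8945 * ε < 1) :
    TorusClusteringOnBallW 3 d (βW / 3) κ (2 * ε) ε 24 κ := by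
  have hd1 : (0 : ℝ) ≤ (d : ℝ) - 1 := by
    have : (2 : ℝ) ≤ d := by exact_mod_cast hd
    linarith
  refine su3_torusClusteringOnBallW_variance hd hP hV hκ hβ0 hR hε0 (lt_of_le_of_lt ?_ hcert)
  have hA : exp (2 * ε) * (14 / 15 * (((d : ℝ) - 1) * βW)) ≤
      (1 + 2 * ε + (2 * ε) ^ 2 / 2 + (2 * ε) ^ 3 / 6 + 5 / 96 * (2 * ε) ^ 4) * (14 / 15 * (((d : ℝ) - 1) * βW)) :=
    mul_le_mul_of_nonneg_right (exp_le_taylor4 (by linarith) (by linarith)) (by positivity)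
  have hB : exp ε * Real.sqrt (4 / 5) * ε ≤ (1 + ε + ε ^ 2 / 2 + ε ^ 3 / 6 + 5 / 96 * ε ^ 4) * 0.8945 * ε :=
    mul_le_mul_of_nonneg_right (mul_le_mul (exp_le_taylor4 hε0 (by linarith)) sqrt_four_fifths_le (Real.sqrt_nonneg _)
      (by positivity)) hε0
  have hkA := mul_le_mul hk hA (by positivity) ((exp_pos κ).le.trans hk)
  linarith

/-! ### 4. Rows of record, `d = 4` (threshold of the door `β_W = 5/14`; class «K × C(H1) × C-iv(H2)») -/

/-- `d = 4` tier-1 row `(β⋆_W, ε) = (1/8, 0.299)`: `TorusClusteringOnBall 3 4 ((1/8)/3) 0.598 0.299 r 24 (rate)` on H1, H2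
(ds-2's U1-route row at `1/8`: `0.23`). [folklore] -/
theorem su3_torusRow4_1_8 (hP : OneLinkPoincareSUN 3 (3 / 5) (4 / 5)) (hV : OneLinkVarianceBound 3 (11 / 30) (49 / 20)) (r : ℕ) :
    TorusClusteringOnBall 3 4 ((1 / 8 : ℝ) / 3) (2 * (299 / 1000)) (299 / 1000) r 24
      (-Real.log (exp (2 * (299 / 1000)) * (14 / 15 * ((((4 : ℕ) : ℝ) - 1) * (1 / 8))) +
          exp (299 / 1000) * Real.sqrt (4 / 5) * (299 / 1000)) / max r 1) :=
  su3_torusRow (by norm_num) hP hV (by norm_num) (by norm_num) (by norm_num) (by norm_num) r (by norm_num)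

/-- `d = 4` tier-1 row `(1/5, 0.181)` (U1 route: `0.118`). [folklore] -/
theorem su3_torusRow4_1_5 (hP : OneLinkPoincareSUN 3 (3 / 5) (4 / 5)) (hV : OneLinkVarianceBound 3 (11 / 30) (49 / 20)) (r : ℕ) :
    TorusClusteringOnBall 3 4 ((1 / 5 : ℝ) / 3) (2 * (181 / 1000)) (181 / 1000) r 24
      (-Real.log (exp (2 * (181 / 1000)) * (14 / 15 * ((((4 : ℕ) : ℝ) - 1) * (1 / 5))) +
          exp (181 / 1000) * Real.sqrt (4 / 5) * (181 / 1000)) / max r 1) :=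
  su3_torusRow (by norm_num) hP hV (by norm_num) (by norm_num) (by norm_num) (by norm_num) r (by norm_num)

/-- `d = 4` tier-1 row `(1/4, 0.116)` (U1 route: `0.069`). [folklore] -/
theorem su3_torusRow4_1_4 (hP : OneLinkPoincareSUN 3 (3 / 5) (4 / 5)) (hV : OneLinkVarianceBound 3 (11 / 30) (49 / 20)) (r : ℕ) :
    TorusClusteringOnBall 3 4 ((1 / 4 : ℝ) / 3) (2 * (29 / 250)) (29 / 250) r 24
      (-Real.log (exp (2 * (29 / 250)) * (14 / 15 * ((((4 : ℕ) : ℝ) - 1) * (1 / 4))) +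
          exp (29 / 250) * Real.sqrt (4 / 5) * (29 / 250)) / max r 1) :=
  su3_torusRow (by norm_num) hP hV (by norm_num) (by norm_num) (by norm_num) (by norm_num) r (by norm_num)

/-- `d = 4` tier-1 row `(3/10, 0.058)` — the largest grid coupling with `ε ≥ 1/20`. [folklore] -/
theorem su3_torusRow4_3_10 (hP : OneLinkPoincareSUN 3 (3 / 5) (4 / 5)) (hV : OneLinkVarianceBound 3 (11 / 30) (49 / 20)) (r : ℕ) :
    TorusClusteringOnBall 3 4 ((3 / 10 : ℝ) / 3) (2 * (29 / 500)) (29 / 500) r 24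
      (-Real.log (exp (2 * (29 / 500)) * (14 / 15 * ((((4 : ℕ) : ℝ) - 1) * (3 / 10))) +
          exp (29 / 500) * Real.sqrt (4 / 5) * (29 / 500)) / max r 1) :=
  su3_torusRow (by norm_num) hP hV (by norm_num) (by norm_num) (by norm_num) (by norm_num) r (by norm_num)

/-- The `∃ A m, 0 < m ∧ …` shape of rb-theory's torus rows at `(1/8, 0.299)`, range `2`, on H1, H2. [folklore] -/
theorem su3_exists_torusClusteringOnBall_oneEighth_variance (hP : OneLinkPoincareSUN 3 (3 / 5) (4 / 5))
    (hV : OneLinkVarianceBound 3 (11 / 30) (49 / 20)) :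
    ∃ A m : ℝ, 0 < m ∧ TorusClusteringOnBall 3 4 ((1 / 8 : ℝ) / 3) (2 * (299 / 1000)) (299 / 1000) 2 A m :=
  ⟨24, _, su3_torusRow_rate_pos (d := 4) (by norm_num) (by norm_num) (by norm_num) (by norm_num) 2 (by norm_num),
    su3_torusRow4_1_8 hP hV 2⟩

/-- `d = 4` TIER-2 row, weight `e^{κ·diam}` with `κ = log(6/5)`: `(β⋆_W, ε) = (1/8, 0.257)`, rate `log(6/5)`, constant `24`. [folklore] -/
theorem su3_torusRowW4_1_8 (hP : OneLinkPoincareSUN 3 (3 / 5) (4 / 5)) (hV : OneLinkVarianceBound 3 (11 / 30) (49 / 20)) :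
    TorusClusteringOnBallW 3 4 ((1 / 8 : ℝ) / 3) (Real.log (6 / 5)) (2 * (257 / 1000)) (257 / 1000) 24 (Real.log (6 / 5)) :=
  su3_torusRowW (d := 4) (by norm_num) hP hV (k := 6 / 5) (Real.log_nonneg (by norm_num))
    (by rw [Real.exp_log (by norm_num)]) (by norm_num) (by norm_num) (by norm_num) (by norm_num) (by norm_num)

/-- `d = 4` TIER-2 row, `κ = log(6/5)`: `(1/5, 0.128)`. [folklore] -/
theorem su3_torusRowW4_1_5 (hP : OneLinkPoincareSUN 3 (3 / 5) (4 / 5)) (hV : OneLinkVarianceBound 3 (11 / 30) (49 / 20)) :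
    TorusClusteringOnBallW 3 4 ((1 / 5 : ℝ) / 3) (Real.log (6 / 5)) (2 * (16 / 125)) (16 / 125) 24 (Real.log (6 / 5)) :=
  su3_torusRowW (d := 4) (by norm_num) hP hV (k := 6 / 5) (Real.log_nonneg (by norm_num))
    (by rw [Real.exp_log (by norm_num)]) (by norm_num) (by norm_num) (by norm_num) (by norm_num) (by norm_num)

/-! ### 5. Rows of record, `d = 3` (threshold `β_W = 15/28`; a Y4 receiving currency is the clustering one) -/

/-- `d = 3` tier-1 row `(β⋆_W, ε) = (1/4, 0.230)`. [folklore] -/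
theorem su3_torusRow3_1_4 (hP : OneLinkPoincareSUN 3 (3 / 5) (4 / 5)) (hV : OneLinkVarianceBound 3 (11 / 30) (49 / 20)) (r : ℕ) :
    TorusClusteringOnBall 3 3 ((1 / 4 : ℝ) / 3) (2 * (23 / 100)) (23 / 100) r 24
      (-Real.log (exp (2 * (23 / 100)) * (14 / 15 * ((((3 : ℕ) : ℝ) - 1) * (1 / 4))) +
          exp (23 / 100) * Real.sqrt (4 / 5) * (23 / 100)) / max r 1) :=
  su3_torusRow (by norm_num) hP hV (by norm_num) (by norm_num) (by norm_num) (by norm_num) r (by norm_num)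

/-- `d = 3` tier-1 row `(3/10, 0.181)`. [folklore] -/
theorem su3_torusRow3_3_10 (hP : OneLinkPoincareSUN 3 (3 / 5) (4 / 5)) (hV : OneLinkVarianceBound 3 (11 / 30) (49 / 20)) (r : ℕ) :
    TorusClusteringOnBall 3 3 ((3 / 10 : ℝ) / 3) (2 * (181 / 1000)) (181 / 1000) r 24
      (-Real.log (exp (2 * (181 / 1000)) * (14 / 15 * ((((3 : ℕ) : ℝ) - 1) * (3 / 10))) +
          exp (181 / 1000) * Real.sqrt (4 / 5) * (181 / 1000)) / max r 1) :=
  su3_torusRow (by norm_num) hP hV (by norm_num) (by norm_num) (by norm_num) (by norm_num) r (by norm_num)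

/-- `d = 3` tier-1 row `(2/5, 0.096)`. [folklore] -/
theorem su3_torusRow3_2_5 (hP : OneLinkPoincareSUN 3 (3 / 5) (4 / 5)) (hV : OneLinkVarianceBound 3 (11 / 30) (49 / 20)) (r : ℕ) :
    TorusClusteringOnBall 3 3 ((2 / 5 : ℝ) / 3) (2 * (12 / 125)) (12 / 125) r 24
      (-Real.log (exp (2 * (12 / 125)) * (14 / 15 * ((((3 : ℕ) : ℝ) - 1) * (2 / 5))) +
          exp (12 / 125) * Real.sqrt (4 / 5) * (12 / 125)) / max r 1) :=
  su3_torusRow (by norm_num) hP hV (by norm_num) (by norm_num) (by norm_num) (by norm_num) r (by norm_num)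

/-- `d = 3` tier-1 row `(9/20, 0.058)`. [folklore] -/
theorem su3_torusRow3_9_20 (hP : OneLinkPoincareSUN 3 (3 / 5) (4 / 5)) (hV : OneLinkVarianceBound 3 (11 / 30) (49 / 20)) (r : ℕ) :
    TorusClusteringOnBall 3 3 ((9 / 20 : ℝ) / 3) (2 * (29 / 500)) (29 / 500) r 24
      (-Real.log (exp (2 * (29 / 500)) * (14 / 15 * ((((3 : ℕ) : ℝ) - 1) * (9 / 20))) +
          exp (29 / 500) * Real.sqrt (4 / 5) * (29 / 500)) / max r 1) :=
  su3_torusRow (by norm_num) hP hV (by norm_num) (by norm_num) (by norm_num) (by norm_num) r (by norm_num)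

/-- `d = 3` TIER-2 row, `κ = log(6/5)`: `(1/4, 0.181)`. [folklore] -/
theorem su3_torusRowW3_1_4 (hP : OneLinkPoincareSUN 3 (3 / 5) (4 / 5)) (hV : OneLinkVarianceBound 3 (11 / 30) (49 / 20)) :
    TorusClusteringOnBallW 3 3 ((1 / 4 : ℝ) / 3) (Real.log (6 / 5)) (2 * (181 / 1000)) (181 / 1000) 24 (Real.log (6 / 5)) :=
  su3_torusRowW (d := 3) (by norm_num) hP hV (k := 6 / 5) (Real.log_nonneg (by norm_num))
    (by rw [Real.exp_log (by norm_num)]) (by norm_num) (by norm_num) (by norm_num) (by norm_num) (by norm_num)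

/-- `d = 3` TIER-2 row, `κ = log(6/5)`: `(1/3, 0.096)`. [folklore] -/
theorem su3_torusRowW3_1_3 (hP : OneLinkPoincareSUN 3 (3 / 5) (4 / 5)) (hV : OneLinkVarianceBound 3 (11 / 30) (49 / 20)) :
    TorusClusteringOnBallW 3 3 ((1 / 3 : ℝ) / 3) (Real.log (6 / 5)) (2 * (12 / 125)) (12 / 125) 24 (Real.log (6 / 5)) :=
  su3_torusRowW (d := 3) (by norm_num) hP hV (k := 6 / 5) (Real.log_nonneg (by norm_num))
    (by rw [Real.exp_log (by norm_num)]) (by norm_num) (by norm_num) (by norm_num) (by norm_num) (by norm_num)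

/-! ### 6. Numbers -/

/-- Numbers: the door's Wilson thresholds `(14/15)(d−1)β_W = 1` at `β_W = 5/14` (`d = 4`), `15/28` (`d = 3`); the radius caps
`(d−1)β_W = 33/20` at `11/20` (`d = 4`), `33/40` (`d = 3`); `0.8945² ≥ 4/5`; and why P35 is not used: `(2/3)(1.6493)·3 > 14/5`. [folklore] -/
theorem su3_torusRows_numbers :
    (14 / 15 : ℝ) * 3 * (5 / 14) = 1 ∧ (14 / 15 : ℝ) * 2 * (15 / 28) = 1 ∧ (3 : ℝ) * (11 / 20) = 33 / 20 ∧
      (2 : ℝ) * (33 / 40) = 33 / 20 ∧ (0.8945 : ℝ) ^ 2 ≥ 4 / 5 ∧ (2 / 3 : ℝ) * 1.6493 * 3 > 14 / 5 := by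
  norm_num

end Summit.Ventures.YMGap.RobustBallSU3

end
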